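import Summits.Ventures.PercRepro.MSTheoremS

/-!
# The tight case of (R*-M) (F3 of Addendum 37)

Dossier proofs/MINE1-theoremS.md, Addendum 37 (F3). Let `L'` be a down-set of subsets of a finite
type containing every singleton, `T` a TIGHT nonempty family with `univ ∖ y ∈ L'` for every member
and EXACTLY `|T| + 1` faces (members of `L'` below a member; the explicit filter form of `faces` of MSTightRStarTop.lean), `u` with `u ∉ L'`, `univ ∖ u ∈ L'`,
satisfying (Sig) and (AO). Then the unique face which is not a difference is a member of `T` inside
`u` — a member of `T` lying in `L'`.

Proof. Every singleton of the support is a face, so (with one exception, the extra face itself)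
every twin class of `T` is a singleton; hence subsets of members are twin-closed and the
difference family, being closed under twin-closed subsets (`mem_flip_of_subset_of_twinClosed`),
is a down-set. Theorem S in its down-closed form then writes `T = L ⊻ U`, `T \\ T = L ⊻ (M − U)`.
The extra face `e` lies inside `M`. If `u ∩ M ∈ L'` then `u ∩ M = e` and `M ∖ e ∈ L'` forces
`e ∈ U`, so `e` is a member inside `u`; otherwise (Sig) at `u ∖ M` makes `u ∖ M` a member of `L`,
and `v₀ ⊆ (v₀ ∖ M) ∪ M ∈ T` contradicts (AO).
-/

namespace PercRepro.MSTight

open Finset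
open scoped FinsetFamily

variable {α : Type*} [DecidableEq α] [Fintype α]

omit [Fintype α] in
/-- A subset of a face is a face. -/
theorem mem_faces_of_subset {L' T : Finset (Finset α)}
    (hdown : ∀ w ∈ L', ∀ w', w' ⊆ w → w' ∈ L') {w w' : Finset α} (hw : w ∈ (L'.filter fun w => ∃ y ∈ T, w ⊆ y))
    (hw' : w' ⊆ w) : w' ∈ (L'.filter fun w => ∃ y ∈ T, w ⊆ y) := by
  obtain ⟨hwL, y, hy, hwy⟩ := mem_filter.1 hw
  exact mem_filter.2 ⟨hdown w hwL w' hw', y, hy, hw'.trans hwy⟩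

/-- The differences of a family with complements in the down-set `L'` are faces. -/
theorem diffs_subset_faces_of_compl_mem {L' T : Finset (Finset α)}
    (hdown : ∀ w ∈ L', ∀ w', w' ⊆ w → w' ∈ L') (hTU : ∀ y ∈ T, Finset.univ \ y ∈ L') :
    T \\ T ⊆ (L'.filter fun w => ∃ y ∈ T, w ⊆ y) := by
  intro d hd
  obtain ⟨y, hy, y', hy', rfl⟩ := mem_diffs.1 hd
  exact mem_filter.2 ⟨hdown _ (hTU y' hy') _ (sdiff_subset_sdiff (subset_univ y) (subset_refl y')),
    y, hy, sdiff_subset⟩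

/-- Two unions of a set outside `M` and a set inside `M` agree iff their parts agree. -/
theorem parts_eq_of_union_eq' {M x x' z z' : Finset α} (hx : x ⊆ Finset.univ \ M)
    (hx' : x' ⊆ Finset.univ \ M) (hz : z ⊆ M) (hz' : z' ⊆ M) (h : x ∪ z = x' ∪ z') :
    x = x' ∧ z = z' := by
  have hxd : Disjoint x M := disjoint_of_subset_left hx disjoint_sdiff_self_left
  have hx'd : Disjoint x' M := disjoint_of_subset_left hx' disjoint_sdiff_self_left
  constructor
  · have e1 : (x ∪ z) \ M = x := by
      rw [union_sdiff_distrib, sdiff_eq_self_of_disjoint hxd, sdiff_eq_empty_iff_subset.2 hz,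
        union_empty]
    have e2 : (x' ∪ z') \ M = x' := by
      rw [union_sdiff_distrib, sdiff_eq_self_of_disjoint hx'd, sdiff_eq_empty_iff_subset.2 hz',
        union_empty]
    rw [← e1, ← e2, h]
  · have e1 : (x ∪ z) ∩ M = z := by
      rw [union_inter_distrib_right, (disjoint_iff_inter_eq_empty.1 hxd), empty_union,
        inter_eq_left.2 hz]
    have e2 : (x' ∪ z') ∩ M = z' := by
      rw [union_inter_distrib_right, (disjoint_iff_inter_eq_empty.1 hx'd), empty_union,
        inter_eq_left.2 hz']
    rw [← e1, ← e2, h]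

/-- In a tight family with exactly one face that is not a difference, every element of a member
is its own twin class (every singleton of the support is a face). -/
theorem cls_eq_singleton_of_faces {L' T : Finset (Finset α)}
    (hsing : ∀ a : α, {a} ∈ L') {e : Finset α}
    (hfaces : ∀ w, w ∈ (L'.filter fun w => ∃ y ∈ T, w ⊆ y) ↔ w ∈ T \\ T ∨ w = e)
    {t : Finset α} (ht : t ∈ T) {a : α} (ha : a ∈ t) : cls T a = {a} := by
  have hsingle : ∀ b ∈ t, ({b} : Finset α) ∈ T \\ T → cls T b = {b} := by
    intro b _ hb
    apply Subset.antisymm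
    · exact cls_subset_of_twinClosed (twinClosed_of_mem_diffs hb) (mem_singleton_self b)
    · exact singleton_subset_iff.2 (self_mem_cls T b)
  have hfa : ({a} : Finset α) ∈ (L'.filter fun w => ∃ y ∈ T, w ⊆ y) := mem_filter.2 ⟨hsing a, t, ht, singleton_subset_iff.2 ha⟩
  rcases (hfaces _).1 hfa with h | h
  · exact hsingle a ha h
  · -- `{a} = e`: any twin `b` of `a` has `{b}` a face, hence a difference (`{b} ≠ e` unless `b = a`)
    apply Subset.antisymm
    · intro b hb
      have hab : Twin T a b := mem_cls.1 hb
      have hbt : b ∈ t := (hab t ht).1 ha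
      have hfb : ({b} : Finset α) ∈ (L'.filter fun w => ∃ y ∈ T, w ⊆ y) :=
        mem_filter.2 ⟨hsing b, t, ht, singleton_subset_iff.2 hbt⟩
      rcases (hfaces _).1 hfb with h' | h'
      · have : cls T b = {b} := hsingle b hbt h'
        have hba : a ∈ cls T b := mem_cls.2 hab.symm
        rw [this, mem_singleton] at hba
        rw [hba]; exact mem_singleton_self b
      · rw [← h] at h'
        rw [singleton_inj] at h'
        rw [h']; exact mem_singleton_self a
    · exact singleton_subset_iff.2 (self_mem_cls T a)

/-- **The tight case of (R*-M).** -/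
theorem exists_mem_of_tight {L' T : Finset (Finset α)}
    (hdown : ∀ w ∈ L', ∀ w', w' ⊆ w → w' ∈ L') (hsing : ∀ a : α, {a} ∈ L')
    (hF : Tight T) (hne : T.Nonempty) (hTU : ∀ y ∈ T, Finset.univ \ y ∈ L')
    (hcard : ((L'.filter fun w => ∃ y ∈ T, w ⊆ y)).card = T.card + 1)
    (u : Finset α) (hu : u ∉ L') (huU : Finset.univ \ u ∈ L')
    (hsig : ∀ v ∈ L', v ⊆ u → u \ v ∈ L' ∨ ∃ y ∈ T, v ⊆ y)
    (hao : ∃ v₀ ∈ L', v₀ ⊆ u ∧ u \ v₀ ∈ L' ∧ ∀ y ∈ T, ¬ v₀ ⊆ y) :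
    ∃ y ∈ T, y ⊆ u ∧ y ∈ L' := by
  obtain ⟨v₀, hv₀, hv₀u, -, hv₀F⟩ := hao
  have hDsub : T \\ T ⊆ (L'.filter fun w => ∃ y ∈ T, w ⊆ y) := diffs_subset_faces_of_compl_mem hdown hTU
  -- the extra face `e`
  have hextra : ((L'.filter fun w => ∃ y ∈ T, w ⊆ y) \ (T \\ T)).card = 1 := by
    rw [card_sdiff, inter_eq_left.2 hDsub, hcard, hF]; omega
  obtain ⟨e, he⟩ := card_eq_one.1 hextra
  have hfaces : ∀ w, w ∈ (L'.filter fun w => ∃ y ∈ T, w ⊆ y) ↔ w ∈ T \\ T ∨ w = e := by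
    intro w
    constructor
    · intro hw
      by_cases hwD : w ∈ T \\ T
      · exact Or.inl hwD
      · right
        have : w ∈ (L'.filter fun w => ∃ y ∈ T, w ⊆ y) \ (T \\ T) := mem_sdiff.2 ⟨hw, hwD⟩
        rw [he, mem_singleton] at this
        exact this
    · intro hw
      rcases hw with hw | hw
      · exact hDsub hw
      · rw [hw]
        have : e ∈ (L'.filter fun w => ∃ y ∈ T, w ⊆ y) \ (T \\ T) := by rw [he]; exact mem_singleton_self e
        exact (mem_sdiff.1 this).1
  have heD : e ∉ T \\ T := by
    have : e ∈ (L'.filter fun w => ∃ y ∈ T, w ⊆ y) \ (T \\ T) := by rw [he]; exact mem_singleton_self e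
    exact (mem_sdiff.1 this).2
  have hef : e ∈ (L'.filter fun w => ∃ y ∈ T, w ⊆ y) := (hfaces e).2 (Or.inr rfl)
  have hempty : (∅ : Finset α) ∈ T \\ T := by
    obtain ⟨t, ht⟩ := hne
    exact mem_diffs.2 ⟨t, ht, t, ht, Finset.sdiff_self t⟩
  have hene : e ≠ ∅ := fun h => heD (h ▸ hempty)
  -- subsets of members are twin-closed, so the differences form a down-set
  have htc : ∀ {t : Finset α}, t ∈ T → ∀ {Z : Finset α}, Z ⊆ t → TwinClosed T Z := by
    intro t ht Z hZ a b hab haZ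
    have hcls := cls_eq_singleton_of_faces hsing hfaces ht (hZ haZ)
    have : b ∈ cls T a := mem_cls.2 hab
    rw [hcls, mem_singleton] at this
    rw [this]; exact haZ
  have hD : IsDownSet (T \\ T) := by
    intro W hW W' hW'
    obtain ⟨t, ht, t', -, rfl⟩ := mem_diffs.1 hW
    have hWflip : t \ t' ∈ flip (Rstar T) T := by
      rw [← diffs_eq_flip_of_tight hF]; exact hW
    rw [diffs_eq_flip_of_tight hF]
    exact mem_flip_of_subset_of_twinClosed (dichotomy_of_tight hF) hWflip hW'
      (htc ht (hW'.trans sdiff_subset))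
  -- Theorem S in its down-closed form
  obtain ⟨M, -, L, U, hL, hLN, hU, hUM, hFLU, hDLU⟩ :=
    exists_downSet_upSet_of_tight_of_isDownSet hF hD (fun A _ => subset_univ A)
  have hLne : L.Nonempty := by
    obtain ⟨t, ht⟩ := hne
    rw [hFLU] at ht
    obtain ⟨x, hx, -, -, -⟩ := mem_sups.1 ht
    exact ⟨x, hx⟩
  have hUne : U.Nonempty := by
    obtain ⟨t, ht⟩ := hne
    rw [hFLU] at ht
    obtain ⟨-, -, z, hz, -⟩ := mem_sups.1 ht
    exact ⟨z, hz⟩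
  have hemptyL : (∅ : Finset α) ∈ L := by
    obtain ⟨x, hx⟩ := hLne
    exact hL x hx ∅ (empty_subset _)
  have hMU : M ∈ U := by
    obtain ⟨z, hz⟩ := hUne
    exact hU z hz M (subset_refl _) (hUM z hz)
  have hUmem : ∀ z ∈ U, z ∈ T := by
    intro z hz
    rw [hFLU]; exact mem_sups.2 ⟨∅, hemptyL, z, hz, by simp⟩
  have hMF : M ∈ T := hUmem M hMU
  have hcomplM : ∀ z' ∈ complWithin M U, z' ⊆ M := by
    intro z' hz'
    obtain ⟨z, -, rfl⟩ := mem_complWithin.1 hz'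
    exact sdiff_subset
  -- the M-part of a difference inside `M`, the L-part of a difference outside `M`
  have hdiffM : ∀ w ∈ T \\ T, w ⊆ M → w ∈ complWithin M U := by
    intro w hw hwM
    rw [hDLU] at hw
    obtain ⟨x, hx, z', hz', hxz⟩ := mem_sups.1 hw
    have hxz' : x ∪ z' = ∅ ∪ w := by simpa using hxz
    obtain ⟨-, rfl⟩ := parts_eq_of_union_eq' (hLN x hx) (empty_subset _) (hcomplM z' hz') hwM hxz'
    exact hz'
  have hdiffN : ∀ w ∈ T \\ T, w ⊆ Finset.univ \ M → w ∈ L := by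
    intro w hw hwN
    rw [hDLU] at hw
    obtain ⟨x, hx, z', hz', hxz⟩ := mem_sups.1 hw
    have hxz' : x ∪ z' = w ∪ ∅ := by simpa using hxz
    obtain ⟨rfl, -⟩ := parts_eq_of_union_eq' (hLN x hx) hwN (hcomplM z' hz') (empty_subset _) hxz'
    exact hx
  -- the extra face lies inside `M`
  have heM : e ⊆ M := by
    obtain ⟨-, t, ht, het⟩ := mem_filter.1 hef
    have hsplit : t = (t \ M) ∪ (t ∩ M) := (sdiff_union_inter t M).symm
    have htL : t \ M ∈ L := by
      rw [hFLU] at ht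
      obtain ⟨x, hx, z, hz, hxz⟩ := mem_sups.1 ht
      have hxz' : x ∪ z = (t \ M) ∪ (t ∩ M) := by rw [← hsplit]; simpa using hxz
      obtain ⟨rfl, -⟩ := parts_eq_of_union_eq' (hLN x hx)
        (sdiff_subset_sdiff (subset_univ t) (subset_refl M)) (hUM z hz) inter_subset_right hxz'
      exact hx
    have heL : e \ M ∈ L := hL _ htL _ (sdiff_subset_sdiff het (subset_refl M))
    have heMf : e ∩ M ∈ (L'.filter fun w => ∃ y ∈ T, w ⊆ y) := mem_faces_of_subset hdown hef inter_subset_left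
    rcases (hfaces _).1 heMf with h | h
    · exfalso
      apply heD
      have hz' : e ∩ M ∈ complWithin M U := hdiffM _ h inter_subset_right
      rw [hDLU]
      refine mem_sups.2 ⟨e \ M, heL, e ∩ M, hz', ?_⟩
      simp [sdiff_union_inter]
    · exact inter_eq_left.1 h
  -- `u` meets every member, so `u ∩ M` is not a complement within `M` of a member of `U`
  have hmeet : ∀ t ∈ T, ¬ Disjoint u t := by
    intro t ht hdis
    apply hu
    exact hdown _ (hTU t ht) u (subset_sdiff.2 ⟨subset_univ _, hdis⟩)
  have huM : u ∩ M ∉ complWithin M U := by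
    intro h
    obtain ⟨z, hz, hzeq⟩ := mem_complWithin.1 h
    apply hmeet z (hUmem z hz)
    rw [disjoint_iff_inter_eq_empty]
    have hzM : z ⊆ M := hUM z hz
    have : u ∩ z = (u ∩ M) ∩ z := by rw [inter_assoc, inter_eq_right.2 hzM]
    rw [this, ← hzeq, inter_comm]
    exact inter_sdiff_self z M
  by_cases huML : u ∩ M ∈ L'
  · -- case (a): `u ∩ M = e`, and `e` is a member inside `u`
    have hf : u ∩ M ∈ (L'.filter fun w => ∃ y ∈ T, w ⊆ y) := mem_filter.2 ⟨huML, M, hMF, inter_subset_right⟩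
    have hue : u ∩ M = e := by
      rcases (hfaces _).1 hf with h | h
      · exact absurd (hdiffM _ h inter_subset_right) huM
      · exact h
    have hMe : M \ e ∈ L' := by
      apply hdown _ huU
      rw [← hue]
      intro a ha
      rw [mem_sdiff] at ha ⊢
      exact ⟨mem_univ a, fun hau => ha.2 (mem_inter.2 ⟨hau, ha.1⟩)⟩
    have hMef : M \ e ∈ (L'.filter fun w => ∃ y ∈ T, w ⊆ y) := mem_filter.2 ⟨hMe, M, hMF, sdiff_subset⟩
    have hMeD : M \ e ∈ T \\ T := by
      rcases (hfaces _).1 hMef with h | h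
      · exact h
      · exfalso
        apply hene
        have h1 : e ∩ (M \ e) = ∅ := inter_sdiff_self e M
        rw [h, inter_self] at h1
        exact h1
    obtain ⟨z, hz, hzeq⟩ := mem_complWithin.1 (hdiffM _ hMeD sdiff_subset)
    have hez : e = z := by
      have h1 : M \ (M \ e) = e := Finset.sdiff_sdiff_eq_self heM
      have h2 : M \ (M \ z) = z := Finset.sdiff_sdiff_eq_self (hUM z hz)
      rw [← h1, ← h2, hzeq]
    refine ⟨e, hez ▸ hUmem z hz, ?_, (mem_filter.1 hef).1⟩
    rw [← hue]; exact inter_subset_left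
  · -- case (b): (Sig) at `u ∖ M` makes it a member of `L`, and `v₀` lies below a member
    have huN : u \ M ∈ L' :=
      hdown _ (hTU M hMF) _ (sdiff_subset_sdiff (subset_univ _) (subset_refl _))
    have huNL : u \ M ∈ L := by
      rcases hsig _ huN sdiff_subset with h | ⟨y, hy, hsub⟩
      · exact absurd (by simpa [sdiff_sdiff_right_self] using h) huML
      · have hf : u \ M ∈ (L'.filter fun w => ∃ y ∈ T, w ⊆ y) := mem_filter.2 ⟨huN, y, hy, hsub⟩
        rcases (hfaces _).1 hf with h | h
        · exact hdiffN _ h (sdiff_subset_sdiff (subset_univ _) (subset_refl _))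
        · exfalso
          apply hene
          have : e ⊆ M ∩ (Finset.univ \ M) := subset_inter heM (h ▸ sdiff_subset_sdiff (subset_univ u) (subset_refl M))
          rw [inter_sdiff_self] at this
          exact subset_empty.1 this
    have hv₀L : v₀ \ M ∈ L := hL _ huNL _ (sdiff_subset_sdiff hv₀u (subset_refl _))
    have hmem : (v₀ \ M) ∪ M ∈ T := by
      rw [hFLU]; exact mem_sups.2 ⟨_, hv₀L, M, hMU, rfl⟩
    exact absurd hmem (fun h => hv₀F _ h (by intro a ha; by_cases haM : a ∈ M <;> simp [ha, haM]))

end PercRepro.MSTight
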